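import Literature.NumberTheory.GaloisRepresentations.SemiLocalUnitGroupShapiro
import Mathlib.RingTheory.Norm.Transitivity
import HarnessLib

/-!
# Integrality in a Galois completion is read off the norm: `v_w(z) ≤ 1 ⟺ v_v(N_{E_w/K_v} z) ≤ 1`, `v_w(z) < 1 ⟺ v_v(N_{E_w/K_v} z) < 1`
# (Cassels–Fröhlich II §10–§11, Serre *Local Fields* II §2: `|z|_w = |N(z)|_v^{1/n}`)

Topic `NumberTheory/GaloisRepresentations`; namespace `Literature.NumberTheory.GaloisRepresentations.SemiLocal`, continuing `SemiLocalUnitGroupShapiro.lean`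
(`valued_algEquiv_place`: the `K_v`-automorphisms of `E_w` preserve `v_w`) and `SemiLocalShapiro.lean` (`isGalois_place`: `E_w/K_v` is Galois for `E/K` Galois).
For a finite Galois extension of number fields `E/K`, a place `w ∣ v`, and `z ∈ E_w`:
* ★ `valued_algebraMap_norm_eq_pow` — `v_w(N_{E_w/K_v} z) = v_w(z)^{[E_w:K_v]}` (`N = ∏_σ σ z`, Mathlib `Algebra.norm_eq_prod_automorphisms`, and `v_w ∘ σ = v_w`);
* ★★ **`valued_le_one_iff_valued_norm_le_one`**, ★★ **`valued_lt_one_iff_valued_norm_lt_one`** — `v_w(z) ≤ 1 ⟺ v_v(N z) ≤ 1` and `v_w(z) < 1 ⟺ v_v(N z) < 1`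
  (with `v_w|_{K_v} = v_v^{e}`, `valued_adicCompletionOfLiesOver`): membership in `𝒪_{E_w}` / in its maximal ideal is decided by the norm down to `K_v`.
Use (cell `bsd-print-cf2`, brick §4(c)/(e), dictionary item D2 «local model» part 2 = LM2 of memo BRICK-C-ORBITS-g22 F39, route (β)): together with the same statement for the
spectral norm on the compositum `K_v(E) ⊆ K̄_v` and `N(θ y) = N(y)` for the compositum isomorphism `θ : K_v(E) ≅ E_w` (`CompletionCompositum`), this transports unit balls and
principal units WITHOUT the integral-closure description of `𝒪_{E_w}`.  Theorems only; no definition, no named fact, no `sorry`, no instance.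

## References
* [CasselsFrohlichANT1967] J. W. S. Cassels, A. Fröhlich (eds.), *Algebraic Number Theory* (1967), Ch. II (Cassels) §10–§11 (`|z|_w = |N_{L_w/K_v} z|_v^{1/n}`).
* [SerreLocalFields1979] J.-P. Serre, *Local Fields* (1979), Ch. II §2 (uniqueness of the extension of the valuation; the formula through the norm).
-/

noncomputable section

open NumberField IsDedekindDomain
open scoped Valued

namespace Literature.NumberTheory.GaloisRepresentations

namespace SemiLocal

open Literature.NumberTheory.Automorphic

variable {F : Type} [Field F] [NumberField F] {E : Type} [Field E] [NumberField E] [Algebra F E] [IsGalois F E]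
variable {v : HeightOneSpectrum (𝓞 F)} (w : Place F E v)

/-- ★ **`v_w(N_{E_w/F_v} z) = v_w(z)^{[E_w : F_v]}`** (the norm is the product of the `Gal(E_w/F_v)`-conjugates, all of the same valuation).
[cite: CasselsFrohlichANT1967, Ch. II §11] [cite: SerreLocalFields1979, Ch. II §2] -/
theorem valued_algebraMap_norm_eq_pow (z : (w : HeightOneSpectrum (𝓞 E)).adicCompletion E) :
    Valued.v (algebraMap (v.adicCompletion F) ((w : HeightOneSpectrum (𝓞 E)).adicCompletion E)
        (Algebra.norm (v.adicCompletion F) z)) =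
      Valued.v z ^ Module.finrank (v.adicCompletion F) ((w : HeightOneSpectrum (𝓞 E)).adicCompletion E) := by
  haveI := finiteDimensional_place (K := F) w
  haveI := isGalois_place (F := F) (E := E) w
  rw [Algebra.norm_eq_prod_automorphisms, map_prod, Finset.prod_congr rfl fun σ _ => valued_algEquiv_place w σ z, Finset.prod_const,
    Finset.card_univ, ← Nat.card_eq_fintype_card, IsGalois.card_aut_eq_finrank]

/-- The local degree `[E_w : F_v]` is positive. [cite: CasselsFrohlichANT1967, Ch. II §10] -/
theorem finrank_place_ne_zero : Module.finrank (v.adicCompletion F) ((w : HeightOneSpectrum (𝓞 E)).adicCompletion E) ≠ 0 := by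
  haveI := finiteDimensional_place (K := F) w
  exact Module.finrank_pos.ne'

omit [IsGalois F E] in
/-- `v_w(ι_w c) ≤ 1 ⟺ v_v(c) ≤ 1` for `c ∈ F_v` (`v_w ∘ ι_w = v_v^{e(w∣v)}`, `e ≥ 1`). [cite: CasselsFrohlichANT1967, Ch. II §10] -/
theorem valued_algebraMap_le_one_iff (c : v.adicCompletion F) :
    Valued.v (algebraMap (v.adicCompletion F) ((w : HeightOneSpectrum (𝓞 E)).adicCompletion E) c) ≤ 1 ↔ Valued.v c ≤ 1 := by
  rw [algebraMap_place_eq, valued_adicCompletionOfLiesOver]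
  exact pow_le_one_iff_of_nonneg zero_le (Ideal.IsDedekindDomain.ramificationIdx'_ne_zero_of_liesOver _ v.ne_bot)

omit [IsGalois F E] in
/-- `v_w(ι_w c) < 1 ⟺ v_v(c) < 1` for `c ∈ F_v`. [cite: CasselsFrohlichANT1967, Ch. II §10] -/
theorem valued_algebraMap_lt_one_iff (c : v.adicCompletion F) :
    Valued.v (algebraMap (v.adicCompletion F) ((w : HeightOneSpectrum (𝓞 E)).adicCompletion E) c) < 1 ↔ Valued.v c < 1 := by
  rw [algebraMap_place_eq, valued_adicCompletionOfLiesOver]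
  exact pow_lt_one_iff_of_nonneg zero_le (Ideal.IsDedekindDomain.ramificationIdx'_ne_zero_of_liesOver _ v.ne_bot)

/-- ★★ **`v_w(z) ≤ 1 ⟺ v_v(N_{E_w/F_v} z) ≤ 1`**: an element of the Galois completion `E_w` is integral iff its norm down to `F_v` is.
[cite: CasselsFrohlichANT1967, Ch. II §11] [cite: SerreLocalFields1979, Ch. II §2] -/
theorem valued_le_one_iff_valued_norm_le_one (z : (w : HeightOneSpectrum (𝓞 E)).adicCompletion E) :
    Valued.v z ≤ 1 ↔ Valued.v (Algebra.norm (v.adicCompletion F) z) ≤ 1 := by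
  rw [← valued_algebraMap_le_one_iff w, valued_algebraMap_norm_eq_pow w z]
  exact (pow_le_one_iff_of_nonneg zero_le (finrank_place_ne_zero w)).symm

/-- ★★ **`v_w(z) < 1 ⟺ v_v(N_{E_w/F_v} z) < 1`**: `z` lies in the maximal ideal of `𝒪_{E_w}` iff its norm lies in the maximal ideal of `𝒪_{F_v}`; applied to `z - 1` this decides
membership in the principal units `U¹_w`. [cite: CasselsFrohlichANT1967, Ch. II §11] [cite: SerreLocalFields1979, Ch. II §2] -/
theorem valued_lt_one_iff_valued_norm_lt_one (z : (w : HeightOneSpectrum (𝓞 E)).adicCompletion E) :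
    Valued.v z < 1 ↔ Valued.v (Algebra.norm (v.adicCompletion F) z) < 1 := by
  rw [← valued_algebraMap_lt_one_iff w, valued_algebraMap_norm_eq_pow w z]
  exact (pow_lt_one_iff_of_nonneg zero_le (finrank_place_ne_zero w)).symm

end SemiLocal

end Literature.NumberTheory.GaloisRepresentations

end
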